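import Mathlib
import HarnessLib
import Literature.MathematicalPhysics.QuantumLattice.GaugeGroups
import Literature.MathematicalPhysics.QuantumFieldTheory.ConstructiveQFTWave0
import Literature.MathematicalPhysics.QuantumFieldTheory.U1GinibreComparison
import Literature.MathematicalPhysics.QuantumFieldTheory.UnitaryCayleyChart
import Summits.Ventures.LatticeQCDFlow.Scaling.LatticeEntropyUN
import Summits.Ventures.LatticeQCDFlow.Scaling.LatticeEntropyU1
import Summits.Ventures.LatticeQCDFlow.Scaling.StaircaseExtensiveAction

/-!
# LatticeQCDFlow / Scaling — the (C2a-R) volume hypothesis for `U(N)` (every `N ≥ 1`) and `U(1)`,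
from the staircase (v2.5)

HONEST FRAMING: exact (Metropolis-corrected) sampling algorithms for lattice gauge theory; figures
of merit are autocorrelation/cost numbers at stated couplings and volumes; no continuum-physics
claim.

Venture `LatticeQCDFlow` (cell pub-lqcd), topic `Scaling`, FANOUT row 29 (theory2) — OUR WORK
(THEORY-2.md v2.5 §3.3, row C2a).  Instances of `Scaling/StaircaseExtensiveAction.lean`
(`extensive_action_of_nonconstant`) for the venture's models: row 30's matrix model
`𝔾 N = Matrix.unitaryGroup (Fin N) ℂ` with `unitaryFundamentalRep`, EVERY `N ≥ 1` (the element
`−1` has `Re tr = −N ≠ N`; row 30's `UN.exists_action_ge` covers `N ≥ 2` only), and the `Circle`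
model with `u1Rep` (the element `exp(iπ)` has `Re tr = −1`).  Both give
`∃ s₀ > 0, ∀ L ≥ 2, ∃ V, s₀·L^d ≤ S(V)` for `d ≥ 2` — the volume hypothesis of (C2a-R)
(`Scaling/ConjecturesRepaired.lean`), so that (C2a-R) for these groups needs only the two-sided
Haar ball-volume bounds and row 30's transport theorem at `L ≥ 2`.  Elementary; nothing cited as a
fact.
-/

noncomputable section

open Real
open Literature.MathematicalPhysics.QuantumFieldTheory
open Literature.MathematicalPhysics.QuantumFieldTheory.UnitaryCayley (𝔾)
open Literature.MathematicalPhysics.QuantumLattice (unitaryFundamentalRep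
  unitaryFundamentalRep_apply u1Rep)

namespace Summit.Ventures.LatticeQCDFlow.Theory2.Lattice

namespace UN

variable {N : ℕ}

/-- `Re tr (−1) = −N` in `U(N)`. [folklore] -/
theorem re_trace_neg_one : (unitaryFundamentalRep (Fin N) ℂ (-1 : 𝔾 N)).trace.re = -(N : ℝ) := by
  rw [unitaryFundamentalRep_apply]
  have h : ((-1 : 𝔾 N) : Matrix (Fin N) (Fin N) ℂ) = -1 := rfl
  rw [h, Matrix.trace_neg, Matrix.trace_one, Fintype.card_fin]
  simp

/-- **(C2a-R) volume hypothesis for `U(N)`, every `N ≥ 1`, `d ≥ 2`**: `∃ s₀ > 0, ∀ L ≥ 2, ∃ V,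
s₀·L^d ≤ S(V)`. [folklore] -/
theorem extensive_action_R {d : ℕ} (hN : 1 ≤ N) (hd : 2 ≤ d) :
    ∃ s₀ : ℝ, 0 < s₀ ∧ ∀ (L : ℕ) [NeZero L], 2 ≤ L →
      ∃ V : GaugeConfig d L (𝔾 N),
        s₀ * (L : ℝ) ^ d ≤ wilsonAction (unitaryFundamentalRep (Fin N) ℂ) V := by
  refine extensive_action_of_nonconstant (unitaryFundamentalRep (Fin N) ℂ) re_trace_le
    ⟨-1, ?_⟩ hd
  rw [re_trace_neg_one]
  have hN' : (1 : ℝ) ≤ N := by exact_mod_cast hN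
  linarith

end UN

namespace U1

/-- `Re tr u1Rep (exp iπ) = −1`. [folklore] -/
theorem re_trace_exp_pi : (u1Rep (Circle.exp π)).trace.re = -1 := by
  rw [trace_u1Rep_re, re_coe_exp, Real.cos_pi]

/-- **(C2a-R) volume hypothesis for `U(1) = Circle`, `d ≥ 2`**: `∃ s₀ > 0, ∀ L ≥ 2, ∃ V,
s₀·L^d ≤ S(V)`. [folklore] -/
theorem extensive_action_R {d : ℕ} (hd : 2 ≤ d) :
    ∃ s₀ : ℝ, 0 < s₀ ∧ ∀ (L : ℕ) [NeZero L], 2 ≤ L →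
      ∃ V : GaugeConfig d L Circle, s₀ * (L : ℝ) ^ d ≤ wilsonAction u1Rep V := by
  refine extensive_action_of_nonconstant u1Rep re_trace_u1Rep_le ⟨Circle.exp π, ?_⟩ hd
  rw [re_trace_exp_pi]
  norm_num

end U1

end Summit.Ventures.LatticeQCDFlow.Theory2.Lattice

end
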